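import Literature.Computability.Cryptography.HondaLeakLeavesUnderBQPCollapse
import Literature.Barriers.QuantumAdvantage.SeparationPrerequisitesProofs
import Literature.Computability.Cryptography.PQCWave0
import Summits.QuantumAdvantage.Statement
import HarnessLib

/-!
# Stub-ideation k1 sketch — helper-lemma STATEMENTS for `stub_phiHiding3` (elaboration check only)
Family 1 (recognise & import): the stub is worst-case Φ-Hiding for `e = 3`; these are the
typed helper lemmas proposed in `STUB-IDEAS-stub_phiHiding3-1.md`. Nothing here is proved.
-/

set_option linter.dupNamespace false

noncomputable section

namespace Summit.QuantumAdvantage.QuantumAdvantage.Cruxes.PureCubicClassNumberHard.PhiHidingImport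

open _root_.Computability Literature.Computability.Complexity Literature.Computability.Complexity.Classes
  Literature.Computability.Cryptography Literature.Computability.QuantumComplexity

/-- The `∃`-body negated by the stub (verbatim). -/
def StubBody : Prop :=
  ∃ D : RandAlg (List Bool) Bool, D.IsPolyTime id encodeBool ∧
    ∀ p q : ℕ, p.Prime → q.Prime → p ≠ q → (p * q) % 9 = 1 →
      ((p % 3 = 1 ∧ q % 3 = 1) ∨ (p % 9 = 2 ∧ q % 9 = 5) ∨ (p % 9 = 5 ∧ q % 9 = 2)) →
      (2 : ℝ) / 3 ≤ D.pr id (encodeNat (p * q)) {b | b = decide (p % 3 = 1)}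

/-- Sanity: `¬ StubBody` is literally the stub's statement. -/
example : (¬ StubBody) =
    (¬ ∃ D : RandAlg (List Bool) Bool, D.IsPolyTime id encodeBool ∧
      ∀ p q : ℕ, p.Prime → q.Prime → p ≠ q → (p * q) % 9 = 1 →
        ((p % 3 = 1 ∧ q % 3 = 1) ∨ (p % 9 = 2 ∧ q % 9 = 5) ∨ (p % 9 = 5 ∧ q % 9 = 2)) →
        (2 : ℝ) / 3 ≤ D.pr id (encodeNat (p * q)) {b | b = decide (p % 3 = 1)}) := rfl

/-! ### IMPORT: the named open conjecture, in standard Φ-hiding vocabulary (CMS99 §2, fixed `e = 3`) -/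

/-- OPEN CONJECTURE (proposed decl) — worst-case decisional Φ-hiding for `e = 3` on squarefree
semiprimes `N ≡ 1 (mod 9)` outside the `(8,8)` class: no PPT decides `3 ∣ φ(N)`. -/
def PhiHidingThreeWorstCase : Prop :=
  ¬ ∃ D : RandAlg (List Bool) Bool, D.IsPolyTime id encodeBool ∧
    ∀ p q : ℕ, p.Prime → q.Prime → p ≠ q → (p * q) % 9 = 1 → ¬ (p % 9 = 8 ∧ q % 9 = 8) →
      (2 : ℝ) / 3 ≤ D.pr id (encodeNat (p * q)) {b | b = decide (3 ∣ Nat.totient (p * q))}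

/-! ### H1–H4: arithmetic normal form and the equivalence -/

/-- H1: the promise is "`N ≡ 1 (mod 9)` and not `p ≡ q ≡ 8 (mod 9)`". -/
theorem promise_iff {p q : ℕ} (hp : p.Prime) (hq : q.Prime) (hpq : p ≠ q) :
    ((p * q) % 9 = 1 ∧
        ((p % 3 = 1 ∧ q % 3 = 1) ∨ (p % 9 = 2 ∧ q % 9 = 5) ∨ (p % 9 = 5 ∧ q % 9 = 2))) ↔
      ((p * q) % 9 = 1 ∧ ¬ (p % 9 = 8 ∧ q % 9 = 8)) := by
  sorry

/-- H2: on the promise (`p ≡ q (mod 3)`), the target bit is the Φ-hiding bit `[3 ∣ φ(pq)]`. -/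
theorem decide_modThree_eq_decide_dvd_totient {p q : ℕ} (hp : p.Prime) (hq : q.Prime)
    (hpq : p ≠ q) (h3 : p % 3 = q % 3) :
    decide (p % 3 = 1) = decide (3 ∣ Nat.totient (p * q)) := by
  sorry

/-- H3: the named conjecture IS the stub (same algorithm both ways; H1 + H2 rewrite the event). -/
theorem phiHidingThreeWorstCase_iff : PhiHidingThreeWorstCase ↔ ¬ StubBody := by
  sorry

/-- H4a (KOS10 "lossy RSA" form, general group lemma): `x ↦ xⁿ` is bijective iff `gcd(|G|, n) = 1`. -/
theorem pow_bijective_iff_coprime_card {G : Type*} [Group G] [Finite G] (n : ℕ) :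
    Function.Bijective (fun x : G => x ^ n) ↔ Nat.Coprime (Nat.card G) n := by
  sorry

/-- H4b: RSA-cubing on `(ℤ/pq)ˣ` is a permutation iff `3 ∤ φ(pq)` (else it is 3- or 9-to-1). -/
theorem pow_three_bijective_iff {p q : ℕ} (hp : p.Prime) (hq : q.Prime) (hpq : p ≠ q) :
    Function.Bijective (fun x : (ZMod (p * q))ˣ => x ^ 3) ↔ ¬ 3 ∣ Nat.totient (p * q) := by
  sorry

/-! ### W0–W2: the hardness wall (why no proof plan exists) -/

/-- W0 (`_false_without_PolyTime` for the stub): drop the time bound and a decider exists —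
the content of the stub is purely a running-time lower bound for `N ↦ [minFac N ≡ 1 (3)]`. -/
theorem stubBody_without_polyTime :
    ∃ D : RandAlg (List Bool) Bool,
      ∀ p q : ℕ, p.Prime → q.Prime → p ≠ q → (p * q) % 9 = 1 →
        ((p % 3 = 1 ∧ q % 3 = 1) ∨ (p % 9 = 2 ∧ q % 9 = 5) ∨ (p % 9 = 5 ∧ q % 9 = 2)) →
        (2 : ℝ) / 3 ≤ D.pr id (encodeNat (p * q)) {b | b = decide (p % 3 = 1)} := by
  sorry

/-- W1 (in tree, 3 lines): the stub alone gives the summit. -/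
theorem quantumAdvantage_of_not_stubBody (h : ¬ StubBody) : _root_.QuantumAdvantage := by
  by_contra hQA
  refine not_BQP_subset_BPP_of_phiHidingThree h ?_
  intro L hL
  by_contra hL'
  exact hQA ⟨L, hL, hL'⟩

/-- W1': hence `P ≠ PSPACE` (barrier `SeparationPrerequisites`, discharged in tree). -/
theorem P_ne_PSPACE_of_not_stubBody (h : ¬ StubBody) : P ≠ PSPACE := by
  have hw : ∃ L : Language Bool, L ∈ BQP ∧ L ∉ BPP := by
    by_contra hno
    exact not_BQP_subset_BPP_of_phiHidingThree h fun L hL => by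
      by_contra hL'
      exact hno ⟨L, hL, hL'⟩
  exact (Literature.Barriers.QuantumAdvantage.SeparationPrerequisites_holds hw).2.2.2

/-- W2 (CMS99 §2 Remark 1, deterministic form): factoring in `FP` breaks the stub. -/
theorem stubBody_of_factoringInFP (h : Literature.Computability.Cryptography.FactoringInFP) : StubBody := by
  sorry

/-! ### R1: the one place the stub is STRONGER than the literature's assumption -/

/-- R1: antitone in the family — the stub implies Φ-hiding(3) on the FULL family `N ≡ 1 (9)`
(including `(8,8)`); the converse is not formal (the `(8,8)` slice). -/
theorem phiHiding_fullFamily_of_not_stubBody (h : ¬ StubBody) :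
    ¬ ∃ D : RandAlg (List Bool) Bool, D.IsPolyTime id encodeBool ∧
      ∀ p q : ℕ, p.Prime → q.Prime → p ≠ q → (p * q) % 9 = 1 →
        (2 : ℝ) / 3 ≤ D.pr id (encodeNat (p * q)) {b | b = decide (3 ∣ Nat.totient (p * q))} := by
  sorry

/-! ### F1: cheapest-falsifier check in Lean — no congruence leak mod 27 from the `(8,8)` exclusion -/

example : ∀ a b : Fin 27, (a.val % 9 = 2 ∧ b.val % 9 = 5) →
    ((a * b).val % 9 = 1) := by decide

/-- Both families hit every class `≡ 1 (mod 9)` modulo 27 (so `N mod 27` carries no bit). -/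
example : ∀ c : Fin 27, c.val % 9 = 1 →
    (∃ a b : Fin 27, a.val % 9 = 2 ∧ b.val % 9 = 5 ∧ a * b = c) ∧
    (∃ a b : Fin 27, a.val % 3 = 1 ∧ b.val % 3 = 1 ∧ a * b = c) := by decide

end Summit.QuantumAdvantage.QuantumAdvantage.Cruxes.PureCubicClassNumberHard.PhiHidingImport
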